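import Summits.CriticalPhenomena.PercolationContinuityZ3.Theorems.PercNearOneGluingNoHeavyLowerTailDualBHKDefs
import Literature.Probability.Percolation.DecisionTreeWeighted
import Mathlib.Combinatorics.SetFamily.FourFunctions
import Mathlib.Algebra.BigOperators.Group.Finset.Powerset
import HarnessLib

/-!
# Dual BHK inequality — block conditioning of weighted masses and the generic Ahlswede–Daykin step

Support file 3/7 for the dual BHK inequality `u_b·u_c ≥ t·n′_a` (memo `prim-ineq-gen-2/DUAL-BHK.md` §8;
`--supports stmt-CriticalPhenomena-4575`).  Weighted-configuration algebra in the lane vocabulary `PrW D p` / `wtW D p`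
(`Literature.Probability.Percolation.DecisionTree`):
* `sum_powerset_union` / `wtW_union_disjoint`: a configuration of `A ∪ B` (disjoint) is a pair of configurations, and the
  weight factorises;  `PrW_local`: an event that ignores the coordinates in `A` has the same mass over `A ∪ B` and over `B`;
* `wtW_inter_mul_union`: the product-weight lattice identity `w(T ∩ T′) w(T ∪ T′) = w(T) w(T′)`;
* `Kset_union_inter` / `Kset_union_union` / `Kset_union_of_avoid`: the open neighbourhood `K` of the peeled vertex is a lattice
  homomorphism of the star configuration and ignores the other edges;
* `ad_step`: **the generic peeling step** (memo §8, step (1) of both theorems): if four events `E₁..E₄` on the universe `U`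
  translate pointwise into events `Gᵢ(K)` on `U ∖ v` (`K` = open neighbours of `v`), the `Gᵢ(K)` ignore the edges at `v`, and
  `PrW(G₁ K)·PrW(G₂ K′) ≤ PrW(G₃ (K ∩ K′))·PrW(G₄ (K ∪ K′))` for all `K, K′` inside the support neighbourhood of `v`, then
  `PrW E₁ · PrW E₂ ≤ PrW E₃ · PrW E₄` — by Mathlib's `Finset.four_functions_theorem` on the star of `v` with
  `fᵢ(T) = wtW_star(T) · PrW(Gᵢ(K(T)))`.  [this work; pattern: VandenbergHaggstromKahn2005 §1, display after (6)]
-/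

namespace Summit.CriticalPhenomena.PercolationContinuityZ3.Theorems

namespace DualBHK

open Finset Literature.Probability.Percolation.DecisionTree
open scoped FinsetFamily

variable {ι : Type*} [DecidableEq ι]

/-! ### Configurations of a disjoint union -/

/-- A sum over the configurations of `A ∪ B` (`A`, `B` disjoint) is a double sum over pairs of configurations. [folklore] -/
theorem sum_powerset_union {A B : Finset ι} (hAB : Disjoint A B) (f : Finset ι → ℝ) :
    ∑ S ∈ (A ∪ B).powerset, f S = ∑ T ∈ A.powerset, ∑ R ∈ B.powerset, f (T ∪ R) := by
  induction A using Finset.induction_on generalizing f with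
  | empty => simp only [Finset.empty_union, Finset.powerset_empty, Finset.sum_singleton]
  | @insert e A heA ih =>
    have heB : e ∉ B := fun h => (Finset.disjoint_insert_left.1 hAB).1 h
    have hAB' : Disjoint A B := (Finset.disjoint_insert_left.1 hAB).2
    have heAB : e ∉ A ∪ B := by
      rw [Finset.mem_union, not_or]; exact ⟨heA, heB⟩
    rw [Finset.insert_union, Finset.sum_powerset_insert heAB, Finset.sum_powerset_insert heA, ih hAB' f,
      ih hAB' (fun S => f (insert e S))]
    congr 1
    refine Finset.sum_congr rfl fun T _ => Finset.sum_congr rfl fun R _ => ?_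
    rw [Finset.insert_union]

/-- The weight of a configuration of a disjoint union factorises. [folklore] -/
theorem wtW_union_disjoint {A B : Finset ι} (hAB : Disjoint A B) (p : ι → ℝ) {T R : Finset ι} (hT : T ⊆ A)
    (hR : R ⊆ B) : wtW (A ∪ B) p (T ∪ R) = wtW A p T * wtW B p R := by
  unfold wtW
  rw [Finset.prod_union hAB]
  congr 1
  · refine Finset.prod_congr rfl fun i hi => ?_
    have : i ∈ T ∪ R ↔ i ∈ T := by
      rw [Finset.mem_union]
      exact ⟨fun h => h.elim id fun h' => absurd (hR h') (Finset.disjoint_left.1 hAB hi), Or.inl⟩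
    simp only [this]
  · refine Finset.prod_congr rfl fun i hi => ?_
    have : i ∈ T ∪ R ↔ i ∈ R := by
      rw [Finset.mem_union]
      exact ⟨fun h => h.elim (fun h' => absurd (hT h') (Finset.disjoint_right.1 hAB hi)) id, Or.inr⟩
    simp only [this]

/-- **Block decomposition of a mass**: `PrW_{A∪B}(X) = Σ_{T ⊆ A} wtW_A(T) · Σ_{R ⊆ B} wtW_B(R) · 1[T ∪ R ∈ X]`. [folklore] -/
theorem PrW_union_eq_sum {A B : Finset ι} (hAB : Disjoint A B) (p : ι → ℝ) (X : Set (Finset ι)) :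
    PrW (A ∪ B) p X = ∑ T ∈ A.powerset, wtW A p T * ∑ R ∈ B.powerset, wtW B p R * ind X (T ∪ R) := by
  rw [PrW_eq_sum_ind, sum_powerset_union hAB]
  refine Finset.sum_congr rfl fun T hT => ?_
  rw [Finset.mul_sum]
  refine Finset.sum_congr rfl fun R hR => ?_
  rw [wtW_union_disjoint hAB p (Finset.mem_powerset.1 hT) (Finset.mem_powerset.1 hR), mul_assoc]

/-- **Locality**: an event that ignores the coordinates of `A` (`T ∪ R ∈ X ↔ R ∈ X` for `T ⊆ A`, `R ⊆ B`) has the same mass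
over `A ∪ B` as over `B`. [folklore] -/
theorem PrW_local {A B : Finset ι} (hAB : Disjoint A B) (p : ι → ℝ) {X : Set (Finset ι)}
    (hX : ∀ T, T ⊆ A → ∀ R, R ⊆ B → (T ∪ R ∈ X ↔ R ∈ X)) : PrW (A ∪ B) p X = PrW B p X := by
  rw [PrW_union_eq_sum hAB]
  have h1 : ∀ T ∈ A.powerset, wtW A p T * ∑ R ∈ B.powerset, wtW B p R * ind X (T ∪ R) =
      wtW A p T * PrW B p X := by
    intro T hT
    rw [PrW_eq_sum_ind]
    congr 1
    refine Finset.sum_congr rfl fun R hR => ?_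
    have h := hX T (Finset.mem_powerset.1 hT) R (Finset.mem_powerset.1 hR)
    by_cases hRX : R ∈ X
    · rw [ind_of_mem hRX, ind_of_mem (h.2 hRX)]
    · rw [ind_of_not_mem hRX, ind_of_not_mem (fun h' => hRX (h.1 h'))]
  rw [Finset.sum_congr rfl h1, ← Finset.sum_mul, sum_wtW, one_mul]

/-- **The product-weight lattice identity** `wtW(T ∩ T′) · wtW(T ∪ T′) = wtW(T) · wtW(T′)`.
[cite: VandenbergHaggstromKahn2005, §1 (display after (6))] -/
theorem wtW_inter_mul_union (A : Finset ι) (p : ι → ℝ) (T T' : Finset ι) :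
    wtW A p (T ∩ T') * wtW A p (T ∪ T') = wtW A p T * wtW A p T' := by
  unfold wtW
  rw [← Finset.prod_mul_distrib, ← Finset.prod_mul_distrib]
  refine Finset.prod_congr rfl fun i _ => ?_
  by_cases h1 : i ∈ T <;> by_cases h2 : i ∈ T' <;> simp [h1, h2, mul_comm]

/-! ### The open neighbourhood of the peeled vertex as a function of the configuration -/

section K

variable {V : Type*} [DecidableEq V] {U : Finset V} {v : V}

omit [DecidableEq V] in
/-- `K` is monotone in the open edge set. [this work] -/
theorem Kset_mono {O O' : Finset (Sym2 V)} (h : O ⊆ O') : Kset U O v ⊆ Kset U O' v :=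
  fun _ hd => ⟨hd.1, hd.2.1, h hd.2.2⟩

/-- Edges away from `v` do not affect `K`. [this work] -/
theorem Kset_union_of_avoid {T R F : Finset (Sym2 V)} (hR : ∀ e ∈ R, v ∉ e) :
    Kset U (T ∪ R ∪ F) v = Kset U (T ∪ F) v := by
  ext d
  simp only [mem_Kset, Finset.mem_union]
  constructor
  · rintro ⟨hU, hne, (hT | hRm) | hF⟩
    · exact ⟨hU, hne, Or.inl hT⟩
    · exact absurd (Sym2.mem_mk_left v d) (hR _ hRm)
    · exact ⟨hU, hne, Or.inr hF⟩
  · rintro ⟨hU, hne, hT | hF⟩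
    · exact ⟨hU, hne, Or.inl (Or.inl hT)⟩
    · exact ⟨hU, hne, Or.inr hF⟩

/-- `K` turns intersections of star configurations into intersections. [this work] -/
theorem Kset_inter_union (T T' F : Finset (Sym2 V)) :
    Kset U (T ∩ T' ∪ F) v = Kset U (T ∪ F) v ∩ Kset U (T' ∪ F) v := by
  ext d
  simp only [mem_Kset, Finset.mem_union, Finset.mem_inter, Set.mem_inter_iff]
  tauto

/-- `K` turns unions of star configurations into unions. [this work] -/
theorem Kset_union_union (T T' F : Finset (Sym2 V)) :
    Kset U (T ∪ T' ∪ F) v = Kset U (T ∪ F) v ∪ Kset U (T' ∪ F) v := by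
  ext d
  simp only [mem_Kset, Finset.mem_union, Set.mem_union]
  tauto

end K

/-! ### The generic Ahlswede–Daykin peeling step -/

section AD

variable {V : Type*} [DecidableEq V]

/-- **Generic peeling step** (memo §8, step (1); BHK's display after (6)).  `D` random edges with weights `p ∈ [0,1]`,
`F` forced edges, `E ⊇ D ∪ F` the support, `v` the peeled vertex of the universe `U`.  Suppose the four events `Eᵢ`
translate pointwise (`S ⊆ D`) into events `Gᵢ (K(S ∪ F))` which ignore the edges at `v`, and that the translated events
satisfy the four-functions hypothesis in `K` for all `K, K′` inside the support neighbourhood `Kset U E v`.  Then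
`PrW E₁ · PrW E₂ ≤ PrW E₃ · PrW E₄`. [this work] -/
theorem ad_step {D F E : Finset (Sym2 V)} {p : Sym2 V → ℝ} (hp0 : ∀ e, 0 ≤ p e) (hp1 : ∀ e, p e ≤ 1)
    (hDE : D ⊆ E) (hFE : F ⊆ E) (U : Finset V) (v : V)
    (E₁ E₂ E₃ E₄ : Set (Finset (Sym2 V))) (G₁ G₂ G₃ G₄ : Set V → Set (Finset (Sym2 V)))
    (htr₁ : ∀ S, S ⊆ D → (S ∈ E₁ ↔ S ∈ G₁ (Kset U (S ∪ F) v)))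
    (htr₂ : ∀ S, S ⊆ D → (S ∈ E₂ ↔ S ∈ G₂ (Kset U (S ∪ F) v)))
    (htr₃ : ∀ S, S ⊆ D → (S ∈ E₃ ↔ S ∈ G₃ (Kset U (S ∪ F) v)))
    (htr₄ : ∀ S, S ⊆ D → (S ∈ E₄ ↔ S ∈ G₄ (Kset U (S ∪ F) v)))
    (hloc₁ : ∀ K (T R : Finset (Sym2 V)), (∀ e ∈ T, v ∈ e) → (T ∪ R ∈ G₁ K ↔ R ∈ G₁ K))
    (hloc₂ : ∀ K (T R : Finset (Sym2 V)), (∀ e ∈ T, v ∈ e) → (T ∪ R ∈ G₂ K ↔ R ∈ G₂ K))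
    (hloc₃ : ∀ K (T R : Finset (Sym2 V)), (∀ e ∈ T, v ∈ e) → (T ∪ R ∈ G₃ K ↔ R ∈ G₃ K))
    (hloc₄ : ∀ K (T R : Finset (Sym2 V)), (∀ e ∈ T, v ∈ e) → (T ∪ R ∈ G₄ K ↔ R ∈ G₄ K))
    (hAD : ∀ K K' : Set V, K ⊆ Kset U E v → K' ⊆ Kset U E v →
      PrW D p (G₁ K) * PrW D p (G₂ K') ≤ PrW D p (G₃ (K ∩ K')) * PrW D p (G₄ (K ∪ K'))) :
    PrW D p E₁ * PrW D p E₂ ≤ PrW D p E₃ * PrW D p E₄ := by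
  -- split `D` into the star `A` of `v` and the rest `B`
  set A : Finset (Sym2 V) := D.filter (fun e => v ∈ e) with hA
  set B : Finset (Sym2 V) := D.filter (fun e => v ∉ e) with hB
  have hAB : Disjoint A B := Finset.disjoint_filter_filter_not D D (fun e => v ∈ e)
  have hDAB : D = A ∪ B := (Finset.filter_union_filter_not_eq (fun e => v ∈ e) D).symm
  have hAv : ∀ T, T ⊆ A → ∀ e ∈ T, v ∈ e := fun T hT e he => (Finset.mem_filter.1 (hT he)).2
  have hBv : ∀ R, R ⊆ B → ∀ e ∈ R, v ∉ e := fun R hR e he => (Finset.mem_filter.1 (hR he)).2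
  have hAD' : ∀ T, T ⊆ A → T ⊆ D := fun T hT => hT.trans (Finset.filter_subset _ _)
  -- locality of the translated events: their `D`-mass is their `B`-mass
  have hlocal : ∀ (G : Set V → Set (Finset (Sym2 V))),
      (∀ K (T R : Finset (Sym2 V)), (∀ e ∈ T, v ∈ e) → (T ∪ R ∈ G K ↔ R ∈ G K)) →
      ∀ K, PrW D p (G K) = PrW B p (G K) := by
    intro G hG K
    rw [hDAB]
    exact PrW_local hAB p fun T hT R _ => hG K T R (hAv T hT)
  -- the four factors as sums over the star configuration
  have hfac : ∀ (Ev : Set (Finset (Sym2 V))) (G : Set V → Set (Finset (Sym2 V))),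
      (∀ S, S ⊆ D → (S ∈ Ev ↔ S ∈ G (Kset U (S ∪ F) v))) →
      (∀ K (T R : Finset (Sym2 V)), (∀ e ∈ T, v ∈ e) → (T ∪ R ∈ G K ↔ R ∈ G K)) →
      PrW D p Ev = ∑ T ∈ A.powerset, wtW A p T * PrW B p (G (Kset U (T ∪ F) v)) := by
    intro Ev G htr hG
    rw [hDAB, PrW_union_eq_sum hAB]
    refine Finset.sum_congr rfl fun T hT => ?_
    have hT' := Finset.mem_powerset.1 hT
    rw [PrW_eq_sum_ind]
    congr 1
    refine Finset.sum_congr rfl fun R hR => ?_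
    have hR' := Finset.mem_powerset.1 hR
    have hTRD : T ∪ R ⊆ D := by
      rw [hDAB]; exact Finset.union_subset_union hT' hR'
    have hK : Kset U (T ∪ R ∪ F) v = Kset U (T ∪ F) v := Kset_union_of_avoid (hBv R hR')
    have h := htr (T ∪ R) hTRD
    rw [hK, hG _ T R (hAv T hT')] at h
    by_cases hm : T ∪ R ∈ Ev
    · rw [ind_of_mem hm, ind_of_mem (h.1 hm)]
    · rw [ind_of_not_mem hm, ind_of_not_mem (fun h' => hm (h.2 h'))]
  rw [hfac E₁ G₁ htr₁ hloc₁, hfac E₂ G₂ htr₂ hloc₂, hfac E₃ G₃ htr₃ hloc₃, hfac E₄ G₄ htr₄ hloc₄]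
  -- Ahlswede–Daykin on the star
  have hnn : ∀ (G : Set V → Set (Finset (Sym2 V))) (T : Finset (Sym2 V)),
      0 ≤ wtW A p T * PrW B p (G (Kset U (T ∪ F) v)) :=
    fun G T => mul_nonneg (wtW_nonneg A hp0 hp1 T) (PrW_nonneg B hp0 hp1 _)
  have key := Finset.four_functions_theorem A
    (f₁ := fun T => wtW A p T * PrW B p (G₁ (Kset U (T ∪ F) v)))
    (f₂ := fun T => wtW A p T * PrW B p (G₂ (Kset U (T ∪ F) v)))
    (f₃ := fun T => wtW A p T * PrW B p (G₃ (Kset U (T ∪ F) v)))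
    (f₄ := fun T => wtW A p T * PrW B p (G₄ (Kset U (T ∪ F) v)))
    (fun T => hnn G₁ T) (fun T => hnn G₂ T) (fun T => hnn G₃ T) (fun T => hnn G₄ T) ?_
    (Finset.Subset.refl A.powerset) (Finset.Subset.refl A.powerset)
  · simpa only [Finset.powerset_infs_powerset_self, Finset.powerset_sups_powerset_self] using key
  -- the four-functions hypothesis: lattice identity × `hAD`
  intro T hT T' hT'
  have hKT : Kset U (T ∪ F) v ⊆ Kset U E v := Kset_mono (Finset.union_subset ((hAD' T hT).trans hDE) hFE)
  have hKT' : Kset U (T' ∪ F) v ⊆ Kset U E v := Kset_mono (Finset.union_subset ((hAD' T' hT').trans hDE) hFE)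
  have h := hAD _ _ hKT hKT'
  rw [hlocal G₁ hloc₁, hlocal G₂ hloc₂, hlocal G₃ hloc₃, hlocal G₄ hloc₄] at h
  have hw := wtW_inter_mul_union A p T T'
  show wtW A p T * PrW B p (G₁ (Kset U (T ∪ F) v)) * (wtW A p T' * PrW B p (G₂ (Kset U (T' ∪ F) v))) ≤
    wtW A p (T ∩ T') * PrW B p (G₃ (Kset U (T ∩ T' ∪ F) v)) *
      (wtW A p (T ∪ T') * PrW B p (G₄ (Kset U (T ∪ T' ∪ F) v)))
  rw [Kset_inter_union, Kset_union_union]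
  calc wtW A p T * PrW B p (G₁ (Kset U (T ∪ F) v)) * (wtW A p T' * PrW B p (G₂ (Kset U (T' ∪ F) v)))
      = (wtW A p T * wtW A p T') * (PrW B p (G₁ (Kset U (T ∪ F) v)) * PrW B p (G₂ (Kset U (T' ∪ F) v))) := by
        ring
    _ ≤ (wtW A p (T ∩ T') * wtW A p (T ∪ T')) *
          (PrW B p (G₃ (Kset U (T ∪ F) v ∩ Kset U (T' ∪ F) v)) *
            PrW B p (G₄ (Kset U (T ∪ F) v ∪ Kset U (T' ∪ F) v))) := by
        rw [hw]
        exact mul_le_mul_of_nonneg_left h (mul_nonneg (wtW_nonneg A hp0 hp1 T) (wtW_nonneg A hp0 hp1 T'))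
    _ = wtW A p (T ∩ T') * PrW B p (G₃ (Kset U (T ∪ F) v ∩ Kset U (T' ∪ F) v)) *
          (wtW A p (T ∪ T') * PrW B p (G₄ (Kset U (T ∪ F) v ∪ Kset U (T' ∪ F) v))) := by ring

end AD

end DualBHK

end Summit.CriticalPhenomena.PercolationContinuityZ3.Theorems
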